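import Mathlib
import Summits.CriticalPhenomena.PercolationContinuityZ3.Theorems.PercNearOneGluingNoHeavyQuantMergeStep
import Summits.CriticalPhenomena.PercolationContinuityZ3.Theorems.PercNearOneGluingNoHeavyQuantIndepBlobThinning
import HarnessLib

/-!
# QUANT lane R8, FAR on trees: the canonical BLOCK-COMB model and its merge step (a root-level blob moves into some other blob
# without raising the tail)

builds on p205010 (kernel theorem, internal audit signed; external expert review pending)

Support file (`--supports stmt-CriticalPhenomena-4575`), QUANT lane seat prim-quant-p1 (gen 8); memo
`run/shared/lean/prim/quant/P1-SURPLUS.md` §19.  Theorems only (local notation, no definitions), no sorries, standard axioms.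
Companion: `…QuantBlockCombStrong.lean` (the induction = FAR at every layer for block-combs in the strong regime).

**Model.**  A chain of `D` gates `q 0, …, q (D−1)` (independent; the chain is open to DEPTH `i` when gates `0..i−1` are open and, if `i < D`,
gate `i` is closed — probability `pd i = (∏_{i'<i} q i')·(1 − q i)` for `i < D` and `∏_{i'<D} q i'` for `i = D`), and blobs `k : κ` with a LEVEL
`lv k ≤ D`, an integer SIZE `a k` (size `0` = a deleted blob) and an independent private GATE `g k`.  Blob `k` is counted when the chain is open to
depth `≥ lv k` and its gate is open; the count is `N = Σ_{k open, lv k ≤ depth} a k` and its tail is the explicit finite sum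
`TAIL = Σ_{i ≤ D} pd i · Σ_{S ⊆ κ} wt S · 𝟙[j+1 ≤ Σ_{k ∈ S, lv k ≤ i} a k]`, `wt S = ∏_k (g k if k ∈ S else 1 − g k)`.
This is the relay count of a BLOCK-COMB (LEAD-NOTES-G10 N21 (0): the least likely relay's chain with blobs on private gates, the terminal
block being a blob of gate `1` at level `D`; root-level blobs = level `0`); the marginal of blob `k` is `(∏_{i < lv k} q i)·g k`.

* `Quant.BlockComb.sum_wt_split` / `sum_wt_mem` / `sum_wt'_eq_one` — product-weight bookkeeping (split at one gate, one-point marginal).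
* `Quant.BlockComb.pd_tail_sum` — `Σ_{ℓ ≤ i ≤ D} pd i = ∏_{i<ℓ} q i` (telescoping).
* `Quant.BlockComb.tail_ge_marg_of_giant` — a blob with `a k ≥ j+1` alone forces the tail above its marginal.
* `Quant.BlockComb.tail_eq_T0` / `tail_transfer_eq_Tl` — the tail written as the `T₀` / `T_ℓ` of `…QuantMergeStep` for a ROOT-LEVEL blob `s`
  (conditioning on all other gates and on the chain depth);  `Quant.BlockComb.tail_transfer_le` — **the merge step on the block-comb**: a live
  root-level blob `s` with `j ≤ g s·Σ_{k≠s} a k` moves into some other live blob `ℓ` (sizes `a ↦ a[s ↦ 0][ℓ ↦ a ℓ + a s]`) without raising the tail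
  (`Quant.Merge.exists_tailMerge_le`).
-/

namespace Summit.CriticalPhenomena.PercolationContinuityZ3.Theorems

namespace Quant

namespace BlockComb

open Finset

variable {κ : Type*} [Fintype κ] [DecidableEq κ]

/-- product-Bernoulli weight of the set `S` of open blob gates -/
local notation3 "wt[" g ", " S "]" => ∏ k, (if k ∈ (S : Finset κ) then (g : κ → ℝ) k else 1 - (g : κ → ℝ) k)

/-- the same weight with the gate of `s` removed -/
local notation3 "wt'[" g ", " s ", " S "]" =>
  ∏ k ∈ (Finset.univ : Finset κ).erase s, (if k ∈ (S : Finset κ) then (g : κ → ℝ) k else 1 - (g : κ → ℝ) k)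

/-- probability that the chain `q` of length `D` is open exactly to depth `i` -/
local notation3 "pd[" D ", " q ", " i "]" =>
  (∏ i' ∈ Finset.range (i : ℕ), (q : ℕ → ℝ) i') * (if (i : ℕ) < (D : ℕ) then 1 - (q : ℕ → ℝ) i else 1)

/-- mass counted at depth `i` in blob configuration `S` -/
local notation3 "mass[" lv ", " a ", " i ", " S "]" =>
  ∑ k ∈ (S : Finset κ).filter (fun k => (lv : κ → ℕ) k ≤ (i : ℕ)), ((a : κ → ℕ) k : ℕ)

/-- the tail `P(N ≥ j+1)` of the block-comb count, as an explicit finite sum -/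
local notation3 "TAIL[" D ", " q ", " lv ", " a ", " g ", " j "]" =>
  ∑ i ∈ Finset.range ((D : ℕ) + 1), pd[D, q, i] *
    ∑ S : Finset κ, wt[g, S] * (if (j : ℕ) + 1 ≤ mass[lv, a, i, S] then (1 : ℝ) else 0)

/-! ### 1. Weights -/

/-- The product weight of a configuration is nonnegative for gates in `[0,1]`. -/
theorem wt_nonneg (g : κ → ℝ) (hg : ∀ k, 0 ≤ g k ∧ g k ≤ 1) (S : Finset κ) : 0 ≤ wt[g, S] :=
  Finset.prod_nonneg fun k _ => by
    split_ifs
    · exact (hg k).1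
    · linarith [(hg k).2]

/-- The product weight without one gate is nonnegative for gates in `[0,1]`. -/
theorem wt'_nonneg (g : κ → ℝ) (hg : ∀ k, 0 ≤ g k ∧ g k ≤ 1) (s : κ) (S : Finset κ) : 0 ≤ wt'[g, s, S] :=
  Finset.prod_nonneg fun k _ => by
    split_ifs
    · exact (hg k).1
    · linarith [(hg k).2]

/-- The depth law is nonnegative for chain gates in `[0,1]`. -/
theorem pd_nonneg (D : ℕ) (q : ℕ → ℝ) (hq : ∀ i, 0 ≤ q i ∧ q i ≤ 1) (i : ℕ) : 0 ≤ pd[D, q, i] := by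
  refine mul_nonneg (Finset.prod_nonneg fun i' _ => (hq i').1) ?_
  split_ifs
  · linarith [(hq i).2]
  · norm_num

/-- Splitting the configuration sum at one blob gate `s`:
`Σ_S wt S · F S = Σ_S 𝟙[s ∉ S]·wt₋ₛ S · (g s · F (insert s S) + (1 − g s) · F S)`. [folklore] -/
theorem sum_wt_split (g : κ → ℝ) (s : κ) (F : Finset κ → ℝ) :
    ∑ S : Finset κ, wt[g, S] * F S =
      ∑ S : Finset κ, (if s ∈ S then 0 else wt'[g, s, S] * (g s * F (insert s S) + (1 - g s) * F S)) := by
  have hs : s ∉ (Finset.univ : Finset κ).erase s := Finset.notMem_erase s _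
  have hidx : (Finset.univ : Finset (Finset κ)) = (insert s ((Finset.univ : Finset κ).erase s)).powerset := by
    rw [Finset.insert_erase (Finset.mem_univ s), Finset.powerset_univ]
  have hL : (∑ S : Finset κ, wt[g, S] * F S) =
      ∑ S ∈ (insert s ((Finset.univ : Finset κ).erase s)).powerset, wt[g, S] * F S := by
    rw [← hidx]
  -- the right-hand side is a sum over `S ∌ s`, i.e. over the powerset of `univ.erase s`
  have hR : (∑ S : Finset κ, (if s ∈ S then 0 else wt'[g, s, S] * (g s * F (insert s S) + (1 - g s) * F S))) =
      ∑ S ∈ ((Finset.univ : Finset κ).erase s).powerset, wt'[g, s, S] * (g s * F (insert s S) + (1 - g s) * F S) := by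
    rw [← Finset.sum_filter_add_sum_filter_not (Finset.univ : Finset (Finset κ)) (fun S => s ∈ S)]
    have h0 : ∑ S ∈ Finset.univ.filter (fun S : Finset κ => s ∈ S),
        (if s ∈ S then 0 else wt'[g, s, S] * (g s * F (insert s S) + (1 - g s) * F S)) = 0 :=
      Finset.sum_eq_zero fun S hS => by rw [if_pos (Finset.mem_filter.1 hS).2]
    rw [h0, zero_add]
    have hset : Finset.univ.filter (fun S : Finset κ => ¬ s ∈ S) = ((Finset.univ : Finset κ).erase s).powerset := by
      ext S
      simp only [Finset.mem_filter, Finset.mem_univ, true_and, Finset.mem_powerset]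
      constructor
      · intro h k hk
        exact Finset.mem_erase.2 ⟨fun hks => h (hks ▸ hk), Finset.mem_univ _⟩
      · intro h hsS
        exact hs (h hsS)
    rw [hset]
    exact Finset.sum_congr rfl fun S hS => by
      rw [Finset.mem_powerset] at hS
      rw [if_neg (fun h => hs (hS h))]
  rw [hL, hR, Finset.sum_powerset_insert hs, ← Finset.sum_add_distrib]
  refine Finset.sum_congr rfl fun S hS => ?_
  rw [Finset.mem_powerset] at hS
  have hsS : s ∉ S := fun h => hs (hS h)
  have hwS : wt[g, S] = (1 - g s) * wt'[g, s, S] := by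
    show (∏ k, (if k ∈ S then g k else 1 - g k)) = _
    rw [← Finset.mul_prod_erase (Finset.univ : Finset κ) _ (Finset.mem_univ s), if_neg hsS]
  have hwI : wt[g, insert s S] = g s * wt'[g, s, S] := by
    show (∏ k, (if k ∈ insert s S then g k else 1 - g k)) = _
    rw [← Finset.mul_prod_erase (Finset.univ : Finset κ) _ (Finset.mem_univ s), if_pos (Finset.mem_insert_self s S)]
    congr 1
    refine Finset.prod_congr rfl fun k hk => ?_
    have hks : k ≠ s := Finset.ne_of_mem_erase hk
    simp only [Finset.mem_insert, hks, false_or]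
  rw [hwS, hwI]
  ring

/-- Total weight without `s` is one: `Σ_{S ⊆ κ∖s} wt₋ₛ S = 1`. [folklore] -/
theorem sum_wt'_eq_one (g : κ → ℝ) (s : κ) :
    ∑ S ∈ ((Finset.univ : Finset κ).erase s).powerset, wt'[g, s, S] = 1 := by
  show (∑ S ∈ ((Finset.univ : Finset κ).erase s).powerset,
    ∏ k ∈ (Finset.univ : Finset κ).erase s, (if k ∈ S then g k else 1 - g k)) = 1
  rw [IndepBlob.sum_powerset_prod_ite_mem]
  exact Finset.prod_eq_one fun k _ => by ring

/-- The one-coordinate marginal: `Σ_S wt S · 𝟙[k ∈ S] = g k`. [folklore] -/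
theorem sum_wt_mem (g : κ → ℝ) (k : κ) :
    ∑ S : Finset κ, wt[g, S] * (if k ∈ S then (1 : ℝ) else 0) = g k := by
  rw [sum_wt_split g k]
  have hin : ∀ S : Finset κ,
      (if k ∈ S then 0 else wt'[g, k, S] *
          (g k * (if k ∈ insert k S then (1 : ℝ) else 0) + (1 - g k) * (if k ∈ S then (1 : ℝ) else 0))) =
        (if k ∈ S then 0 else g k * wt'[g, k, S]) := by
    intro S
    by_cases hkS : k ∈ S
    · rw [if_pos hkS, if_pos hkS]
    · rw [if_neg hkS, if_neg hkS, if_pos (Finset.mem_insert_self k S), if_neg hkS]; ring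
  simp_rw [hin]
  rw [← Finset.sum_filter_add_sum_filter_not (Finset.univ : Finset (Finset κ)) (fun S => k ∈ S)]
  have h0 : ∑ S ∈ Finset.univ.filter (fun S : Finset κ => k ∈ S), (if k ∈ S then 0 else g k * wt'[g, k, S]) = 0 :=
    Finset.sum_eq_zero fun S hS => by rw [if_pos (Finset.mem_filter.1 hS).2]
  rw [h0, zero_add]
  have hset : Finset.univ.filter (fun S : Finset κ => ¬ k ∈ S) = ((Finset.univ : Finset κ).erase k).powerset := by
    ext S
    simp only [Finset.mem_filter, Finset.mem_univ, true_and, Finset.mem_powerset]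
    constructor
    · intro h k' hk'
      exact Finset.mem_erase.2 ⟨fun hks => h (hks ▸ hk'), Finset.mem_univ _⟩
    · intro h hkS
      exact Finset.notMem_erase k _ (h hkS)
  rw [hset]
  have hin2 : ∀ S ∈ ((Finset.univ : Finset κ).erase k).powerset,
      (if k ∈ S then 0 else g k * wt'[g, k, S]) = g k * wt'[g, k, S] := by
    intro S hS
    rw [Finset.mem_powerset] at hS
    rw [if_neg (fun h => Finset.notMem_erase k _ (hS h))]
  rw [Finset.sum_congr rfl hin2, ← Finset.mul_sum, sum_wt'_eq_one, mul_one]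

/-! ### 2. The depth law: telescoping -/

/-- `Σ_{ℓ ≤ i ≤ D} pd i = ∏_{i < ℓ} q i`: the chain is open to depth at least `ℓ` with probability the prefix product. [folklore] -/
theorem pd_tail_sum (q : ℕ → ℝ) : ∀ (D ℓ : ℕ), ℓ ≤ D →
    ∑ i ∈ (Finset.range (D + 1)).filter (fun i => ℓ ≤ i), pd[D, q, i] = ∏ i ∈ Finset.range ℓ, q i := by
  intro D
  induction D with
  | zero =>
    intro ℓ hℓ
    have hℓ0 : ℓ = 0 := Nat.le_zero.1 hℓ
    subst hℓ0
    simp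
  | succ D ih =>
    intro ℓ hℓ
    rcases Nat.lt_or_ge ℓ (D + 1) with hlt | hge
    · -- use the induction hypothesis: compare the two depth laws term by term
      have hsplit : (Finset.range (D + 1 + 1)).filter (fun i => ℓ ≤ i) =
          insert (D + 1) ((Finset.range (D + 1)).filter (fun i => ℓ ≤ i)) := by
        ext i
        simp only [Finset.mem_filter, Finset.mem_range, Finset.mem_insert]
        omega
      have hnot : (D + 1) ∉ (Finset.range (D + 1)).filter (fun i => ℓ ≤ i) := by simp
      rw [hsplit, Finset.sum_insert hnot]
      -- the top term
      have htop : pd[D + 1, q, D + 1] = (∏ i ∈ Finset.range (D + 1), q i) := by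
        show (∏ i' ∈ Finset.range (D + 1), q i') * (if D + 1 < D + 1 then 1 - q (D + 1) else 1) = _
        rw [if_neg (lt_irrefl _), mul_one]
      -- the other terms: `pd[D+1] i = pd[D] i` for `i < D`, and at `i = D` they differ by `∏_{<D} q · q D`
      have hsplit2 : (Finset.range (D + 1)).filter (fun i => ℓ ≤ i) =
          insert D ((Finset.range D).filter (fun i => ℓ ≤ i)) := by
        ext i
        simp only [Finset.mem_filter, Finset.mem_range, Finset.mem_insert]
        omega
      have hnot2 : D ∉ (Finset.range D).filter (fun i => ℓ ≤ i) := by simp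
      have hih := ih ℓ (by omega)
      rw [hsplit2, Finset.sum_insert hnot2] at hih ⊢
      have hsame : ∑ i ∈ (Finset.range D).filter (fun i => ℓ ≤ i), pd[D + 1, q, i] =
          ∑ i ∈ (Finset.range D).filter (fun i => ℓ ≤ i), pd[D, q, i] := by
        refine Finset.sum_congr rfl fun i hi => ?_
        have hiD : i < D := Finset.mem_range.1 (Finset.mem_filter.1 hi).1
        show (∏ i' ∈ Finset.range i, q i') * (if i < D + 1 then 1 - q i else 1) =
          (∏ i' ∈ Finset.range i, q i') * (if i < D then 1 - q i else 1)
        rw [if_pos hiD, if_pos (by omega)]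
      have hD1 : pd[D + 1, q, D] = (∏ i' ∈ Finset.range D, q i') * (1 - q D) := by
        show (∏ i' ∈ Finset.range D, q i') * (if D < D + 1 then 1 - q D else 1) = _
        rw [if_pos (by omega)]
      have hD0 : pd[D, q, D] = (∏ i' ∈ Finset.range D, q i') := by
        show (∏ i' ∈ Finset.range D, q i') * (if D < D then 1 - q D else 1) = _
        rw [if_neg (lt_irrefl _), mul_one]
      rw [hsame, htop, hD1, Finset.prod_range_succ]
      rw [hD0] at hih
      linarith
    · -- `ℓ = D + 1`: a single term
      have hℓ' : ℓ = D + 1 := le_antisymm hℓ hge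
      subst hℓ'
      have hset : (Finset.range (D + 1 + 1)).filter (fun i => D + 1 ≤ i) = {D + 1} := by
        ext i
        simp only [Finset.mem_filter, Finset.mem_range, Finset.mem_singleton]
        omega
      rw [hset, Finset.sum_singleton]
      show (∏ i' ∈ Finset.range (D + 1), q i') * (if D + 1 < D + 1 then 1 - q (D + 1) else 1) = _
      rw [if_neg (lt_irrefl _), mul_one]

/-! ### 3. A giant blob forces the tail above its marginal -/

/-- **Giant.**  If blob `k` (level `lv k ≤ D`) carries `a k ≥ j+1` relays then `TAIL ≥ (∏_{i<lv k} q i)·g k`. [this work] -/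
theorem tail_ge_marg_of_giant (D : ℕ) (q : ℕ → ℝ) (hq : ∀ i, 0 ≤ q i ∧ q i ≤ 1) (lv : κ → ℕ) (a : κ → ℕ)
    (g : κ → ℝ) (hg : ∀ k, 0 ≤ g k ∧ g k ≤ 1) (j : ℕ) (k : κ) (hk : j + 1 ≤ a k) (hlvk : lv k ≤ D) :
    (∏ i ∈ Finset.range (lv k), q i) * g k ≤ TAIL[D, q, lv, a, g, j] := by
  -- lower bound each inner sum by `𝟙[lv k ≤ i]·g k`
  have hinner : ∀ i ∈ Finset.range (D + 1),
      (if lv k ≤ i then g k else 0) ≤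
        ∑ S : Finset κ, wt[g, S] * (if j + 1 ≤ mass[lv, a, i, S] then (1 : ℝ) else 0) := by
    intro i _
    by_cases hi : lv k ≤ i
    · rw [if_pos hi, ← sum_wt_mem g k]
      refine Finset.sum_le_sum fun S _ => mul_le_mul_of_nonneg_left ?_ (wt_nonneg g hg S)
      by_cases hkS : k ∈ S
      · have hmass : j + 1 ≤ mass[lv, a, i, S] := by
          show j + 1 ≤ ∑ k' ∈ S.filter (fun k' => lv k' ≤ i), a k'
          have hmem : k ∈ S.filter (fun k' => lv k' ≤ i) := Finset.mem_filter.2 ⟨hkS, hi⟩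
          exact le_trans hk (Finset.single_le_sum (fun _ _ => Nat.zero_le _) hmem)
        rw [if_pos hkS, if_pos hmass]
      · rw [if_neg hkS]; split_ifs <;> norm_num
    · rw [if_neg hi]
      exact Finset.sum_nonneg fun S _ => mul_nonneg (wt_nonneg g hg S) (by split_ifs <;> norm_num)
  calc (∏ i ∈ Finset.range (lv k), q i) * g k
      = (∑ i ∈ (Finset.range (D + 1)).filter (fun i => lv k ≤ i), pd[D, q, i]) * g k := by
        rw [pd_tail_sum q D (lv k) hlvk]
    _ = ∑ i ∈ Finset.range (D + 1), pd[D, q, i] * (if lv k ≤ i then g k else 0) := by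
        rw [Finset.sum_filter, Finset.sum_mul]
        refine Finset.sum_congr rfl fun i _ => ?_
        by_cases hi : lv k ≤ i
        · rw [if_pos hi, if_pos hi]
        · rw [if_neg hi, if_neg hi, zero_mul, mul_zero]
    _ ≤ TAIL[D, q, lv, a, g, j] :=
        Finset.sum_le_sum fun i hi => mul_le_mul_of_nonneg_left (hinner i hi) (pd_nonneg D q hq i)


/-! ### 4. The merge step for a root-level blob -/

omit [Fintype κ] in
/-- Mass is unchanged by modifying the size of a blob outside the configuration. -/
theorem mass_update_of_notMem (lv : κ → ℕ) (a : κ → ℕ) (s : κ) (v i : ℕ) (S : Finset κ) (hs : s ∉ S) :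
    mass[lv, Function.update a s v, i, S] = mass[lv, a, i, S] := by
  refine Finset.sum_congr rfl fun k hk => ?_
  have hks : k ≠ s := fun h => hs (h ▸ (Finset.mem_filter.1 hk).1)
  rw [Function.update_of_ne hks]

omit [Fintype κ] in
/-- Inserting a root-level blob `s` (so `lv s ≤ i` at every depth) adds its size. -/
theorem mass_insert (lv : κ → ℕ) (a : κ → ℕ) (s : κ) (i : ℕ) (S : Finset κ) (hs : s ∉ S) (hlv : lv s ≤ i) :
    mass[lv, a, i, insert s S] = mass[lv, Function.update a s 0, i, S] + a s := by
  have hfilter : (insert s S).filter (fun k => lv k ≤ i) = insert s (S.filter fun k => lv k ≤ i) := by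
    rw [Finset.filter_insert, if_pos hlv]
  have hs' : s ∉ S.filter (fun k => lv k ≤ i) := fun h => hs (Finset.mem_filter.1 h).1
  show (∑ k ∈ (insert s S).filter (fun k => lv k ≤ i), a k) = (∑ k ∈ S.filter (fun k => lv k ≤ i), Function.update a s 0 k) + a s
  rw [hfilter, Finset.sum_insert hs', add_comm]
  congr 1
  exact (mass_update_of_notMem lv a s 0 i S hs).symm

omit [Fintype κ] in
/-- The transferred size vector: on a configuration avoiding `s`, moving `b` extra relays onto blob `ℓ ≠ s` adds `b` exactly when `ℓ` is counted. -/
theorem mass_transfer (lv : κ → ℕ) (a₀ : κ → ℕ) (ℓ : κ) (b i : ℕ) (S : Finset κ) :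
    mass[lv, Function.update a₀ ℓ (a₀ ℓ + b), i, S] =
      mass[lv, a₀, i, S] + (if ℓ ∈ S.filter (fun k => lv k ≤ i) then b else 0) := by
  show (∑ k ∈ S.filter (fun k => lv k ≤ i), Function.update a₀ ℓ (a₀ ℓ + b) k) =
    (∑ k ∈ S.filter (fun k => lv k ≤ i), a₀ k) + (if ℓ ∈ S.filter (fun k => lv k ≤ i) then b else 0)
  by_cases hℓ : ℓ ∈ S.filter (fun k => lv k ≤ i)
  · rw [if_pos hℓ, Finset.sum_update_of_mem hℓ, Finset.sum_eq_add_sum_sdiff_singleton_of_mem hℓ a₀]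
    ring
  · rw [if_neg hℓ, Finset.sum_update_of_notMem hℓ, add_zero]

/-- **The tail as `T₀` of the merge step** (root-level blob `s`, conditioning on all other gates and the chain depth). -/
theorem tail_eq_T0 (D : ℕ) (q : ℕ → ℝ) (lv : κ → ℕ) (a : κ → ℕ) (g : κ → ℝ) (j : ℕ) (s : κ) (hs0 : lv s = 0) :
    TAIL[D, q, lv, a, g, j] =
      ∑ ω : Fin (D + 1) × Finset κ, (pd[D, q, (ω.1 : ℕ)] * (if s ∈ ω.2 then 0 else wt'[g, s, ω.2])) *
        (g s * (if j + 1 ≤ mass[lv, Function.update a s 0, (ω.1 : ℕ), ω.2] + 0 + a s then (1 : ℝ) else 0) +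
          (1 - g s) * (if j + 1 ≤ mass[lv, Function.update a s 0, (ω.1 : ℕ), ω.2] + 0 then (1 : ℝ) else 0)) := by
  rw [Fintype.sum_prod_type]
  rw [← Fin.sum_univ_eq_sum_range (fun i => pd[D, q, i] *
    ∑ S : Finset κ, wt[g, S] * (if j + 1 ≤ mass[lv, a, i, S] then (1 : ℝ) else 0)) (D + 1)]
  refine Finset.sum_congr rfl fun i _ => ?_
  rw [sum_wt_split g s, Finset.mul_sum]
  refine Finset.sum_congr rfl fun S _ => ?_
  by_cases hsS : s ∈ S
  · simp only [if_pos hsS, mul_zero, zero_mul]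
  · rw [if_neg hsS, if_neg hsS, mass_insert lv a s _ S hsS (by rw [hs0]; exact Nat.zero_le _),
      mass_update_of_notMem lv a s 0 _ S hsS, add_zero]
    ring

/-- **The tail after the transfer as `T_ℓ` of the merge step.** -/
theorem tail_transfer_eq_Tl (D : ℕ) (q : ℕ → ℝ) (lv : κ → ℕ) (a : κ → ℕ) (g : κ → ℝ) (j : ℕ) (s ℓ : κ)
    (hs0 : lv s = 0) (hℓs : ℓ ≠ s) :
    TAIL[D, q, lv, Function.update (Function.update a s 0) ℓ (Function.update a s 0 ℓ + a s), g, j] =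
      ∑ ω : Fin (D + 1) × Finset κ, (pd[D, q, (ω.1 : ℕ)] * (if s ∈ ω.2 then 0 else wt'[g, s, ω.2])) *
        (if j + 1 ≤ mass[lv, Function.update a s 0, (ω.1 : ℕ), ω.2] + 0 +
            (if ℓ ∈ ω.2.filter (fun k => lv k ≤ (ω.1 : ℕ)) then a s else 0) then (1 : ℝ) else 0) := by
  set a₀ := Function.update a s 0 with ha₀
  set aT := Function.update a₀ ℓ (a₀ ℓ + a s) with haT
  have haTs : aT s = 0 := by
    rw [haT, Function.update_of_ne hℓs.symm, ha₀, Function.update_self]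
  rw [Fintype.sum_prod_type]
  rw [← Fin.sum_univ_eq_sum_range (fun i => pd[D, q, i] *
    ∑ S : Finset κ, wt[g, S] * (if j + 1 ≤ mass[lv, aT, i, S] then (1 : ℝ) else 0)) (D + 1)]
  refine Finset.sum_congr rfl fun i _ => ?_
  rw [sum_wt_split g s, Finset.mul_sum]
  refine Finset.sum_congr rfl fun S _ => ?_
  by_cases hsS : s ∈ S
  · simp only [if_pos hsS, mul_zero, zero_mul]
  · -- inserting `s` does not change the mass (its size is `0` after the transfer)
    have hins : mass[lv, aT, (i : ℕ), insert s S] = mass[lv, aT, (i : ℕ), S] := by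
      have h1 := mass_insert lv aT s (i : ℕ) S hsS (by rw [hs0]; exact Nat.zero_le _)
      rw [h1, haTs, add_zero, mass_update_of_notMem lv aT s 0 _ S hsS]
    have htr : mass[lv, aT, (i : ℕ), S] = mass[lv, a₀, (i : ℕ), S] +
        (if ℓ ∈ S.filter (fun k => lv k ≤ (i : ℕ)) then a s else 0) := by
      rw [haT]; exact mass_transfer lv a₀ ℓ (a s) i S
    rw [if_neg hsS, if_neg hsS, hins, htr, add_zero]
    ring

/-- **Merge step on the block-comb.**  A live ROOT-LEVEL blob `s` with `j ≤ g s·(Σ_{k ≠ s} a k)` can be moved into some other live blob `ℓ`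
without raising the tail. [this work] -/
theorem tail_transfer_le (D : ℕ) (q : ℕ → ℝ) (hq : ∀ i, 0 ≤ q i ∧ q i ≤ 1) (lv : κ → ℕ) (a : κ → ℕ)
    (g : κ → ℝ) (hg : ∀ k, 0 ≤ g k ∧ g k ≤ 1) (j : ℕ) (s : κ) (hs0 : lv s = 0)
    (hM : (j : ℝ) ≤ g s * ∑ k, ((Function.update a s 0 k : ℕ) : ℝ)) (hpos : ∃ k, 0 < Function.update a s 0 k) :
    ∃ ℓ, 0 < Function.update a s 0 ℓ ∧
      TAIL[D, q, lv, Function.update (Function.update a s 0) ℓ (Function.update a s 0 ℓ + a s), g, j] ≤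
        TAIL[D, q, lv, a, g, j] := by
  have hμ : ∀ ω : Fin (D + 1) × Finset κ, 0 ≤ pd[D, q, (ω.1 : ℕ)] * (if s ∈ ω.2 then 0 else wt'[g, s, ω.2]) :=
    fun ω => mul_nonneg (pd_nonneg D q hq _) (by split_ifs <;> first | exact le_rfl | exact wt'_nonneg g hg s _)
  obtain ⟨ℓ, hℓ, hle⟩ := Merge.exists_tailMerge_le
    (fun ω : Fin (D + 1) × Finset κ => pd[D, q, (ω.1 : ℕ)] * (if s ∈ ω.2 then 0 else wt'[g, s, ω.2])) hμ
    (fun ω => ω.2.filter (fun k => lv k ≤ (ω.1 : ℕ))) (fun _ => 0) (Function.update a s 0) (a s) j (g s) hM hpos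
  have hℓs : ℓ ≠ s := by
    intro h; rw [h, Function.update_self] at hℓ; exact lt_irrefl _ hℓ
  refine ⟨ℓ, hℓ, ?_⟩
  rw [tail_transfer_eq_Tl D q lv a g j s ℓ hs0 hℓs, tail_eq_T0 D q lv a g j s hs0]
  exact hle

end BlockComb

end Quant

end Summit.CriticalPhenomena.PercolationContinuityZ3.Theorems
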